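import Mathlib
import Literature.RingTheory.CohomologyAnnihilator.BirationalTransfer
import Summits.ResolutionOfSingularities.ResolutionOfSingularities.Theorems.HomologicalConductorPersistenceHullTransfer
import Summits.ResolutionOfSingularities.ResolutionOfSingularities.Theorems.HomologicalConductorNoZenoReflexiveHull
import HarnessLib

/-!
# The hull lemma: stable annihilation over a birational subring passes to the reflexive hull
# of the span (exponent one)

`[OURS · L1 w44b · idea-2 g6]` — helper for the crux `HomologicalConductor.Persistence`
(stmt-ResolutionOfSingularities-16484) and its surface rung `PersistenceSurface`
(stmt-ResolutionOfSingularities-19970); the typed second half (R5.8 `FactorsThroughFreeReflexiveHull`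
of `L/res-L1-w44b-idea-2/Sketch-L1-idea-2.lean` v5) of the **HULL LEMMA** of memo
`L/res-L1-w44b-idea-2/ROUND5-FASC.md` §3 (H), which is the certificate engine behind the Σ8 / F-asc
verdict of CHAIN w44b v9 §V9.2 (N).  NOT a statement of the manuscript under adjudication in cell
res-hironaka; nothing here is attributed to its author; elementary linear algebra, AI-written (weaker than
expert review).

**Setting.** `T₀ ≤ S` are subalgebras of a field `K` with `S ⊆ Frac T₀` inside `K`
(`∀ s ∈ S, ∃ b ∈ T₀, b ≠ 0 ∧ b * s ∈ T₀` — e.g. `S` = the normalisation of a non-normal germ `T₀`, or an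
affine blow-up chart), `V` a `K`-vector space, `Y₀ ⊆ V` a `↥T₀`-submodule and `Y = S · Y₀ ⊆ V` the
`↥S`-submodule it spans.  A *stable factorisation* of `c` on a module `M` is a pair `M —ι→ Rˢ —π→ M` with
`π ∘ ι = c • id` (kept UNFOLDED, as in the sibling `…PersistenceHullTransfer`; by the tree's
`smul_ext_eq_zero_of_linearMap_comp_eq_smul_id` it forces `c · Ext^{≥1}_R(M, −) = 0` with EXPONENT ONE).

**The lemma (three steps, all exponent one).**
1. `Subalgebra.exists_comp_eq_smul_id_of_span_eq` — a `↥T₀`-linear stable factorisation of `c : T₀`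
   on `Y₀` through `T₀ˢ` yields an `↥S`-linear stable factorisation of `c` on the SPAN `Y = S · Y₀`
   through `Sˢ` (base change `S ⊗ Y₀ → S ⊗ T₀ˢ ≅ Sˢ`, then descent along the multiplication map
   `S ⊗_{T₀} Y₀ ↠ Y`, whose kernel is `T₀⁰`-torsion and hence dies in the torsion-free `S ⊗ T₀ˢ`:
   tree `baseChange_comp_baseChange_eq_smul_id`, `ker_liftBaseChange_le_ker`,
   `exists_comp_eq_smul_id_of_surjective`).  The landed `Subalgebra.smul_ext_eq_zero_of_span_eq`
   states only the `Ext` consequence of this step; the FACTORISATION is what step 2 needs.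
2. `exists_comp_eq_smul_id_reflexiveHull` — for a finitely generated lattice `N` in a vector space
   over a field through which the domain `S` acts, a stable factorisation of `x` on `N` through `Sˢ`
   yields one on the REFLEXIVE HULL `reflexiveHull N ⊆ W` (tree, `…NoZenoReflexiveHull`): double
   dualisation fixes `Sˢ` (sibling `exists_comp_eq_smul_id_dual_dual`) and `reflexiveHull N ≃ₗ N**`
   (tree `reflexiveHullEquiv`).  `smul_ext_eq_zero_reflexiveHull` is its `Ext` form.
3. `Subalgebra.exists_comp_eq_smul_id_reflexiveHull_of_span_eq` /
   `Subalgebra.smul_ext_eq_zero_reflexiveHull_of_span_eq` — 1 + 2: **if `c • id_{Y₀}` factors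
   `↥T₀`-linearly through `T₀ˢ`, then `c` kills `Extⁱ_S((S · Y₀)**, N)` for every `↥S`-module `N` and
   every `i ≥ 1`**, `(S · Y₀)** = reflexiveHull (S · Y₀) ⊆ V`.  The bare-inclusion forms
   (`…_of_le_of_span_eq`) spell out the instance plumbing for `T₀ ≤ S`.

Why the cell wants it (memo §3 (H), CHAIN v9 §V9.2 (N)): at an ISOLATED non-normal stage-0 germ `T₀`
with normalisation `S`, `c ∈ sann_{T₀}(Ωʲ_{T₀} X)` is decided by a finite window, and the hull lemma
turns a `T₀`-certificate into an `S`-certificate on the computable reflexive `S`-module `(S·Ωʲ X)**`,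
where `ca(S)` is known (`S = A₃`: finite CM type); this is how `z ∉ ca³(T₀)` and the F-asc verdict at the
Σ8 specimen `T₀ = k + (x², y, z)A₃` were certified (jobs j271146 / j271831 / j272405).  No depth,
dimension or noetherian hypothesis enters steps 1–3 beyond `Module.Finite` for the hull.

References: W. Bruns, J. Herzog, *Cohen–Macaulay rings*, CUP 1998, Prop. 1.4.1 (reflexive hull = double
dual) [`BrunsHerzog1998`]; the stable-annihilation formalism is folklore (Buchweitz 1986; Iyengar–Takahashi,
arXiv:1404.1476, §2) [`IyengarTakahashi2014`].
-/

-- single-problem summit: the doubled namespace component is forced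
set_option linter.dupNamespace false

noncomputable section

open CategoryTheory CategoryTheory.Abelian Module
open scoped TensorProduct

universe u v w

namespace Summit.ResolutionOfSingularities.ResolutionOfSingularities.Theorems.HomologicalConductor.PersistenceReflexiveHullTransfer

open Literature.RingTheory.CohomologyAnnihilator
open Literature.RingTheory.Localization
open Summit.ResolutionOfSingularities.ResolutionOfSingularities.Theorems.NoZeno.SandwichCluster
open Summit.ResolutionOfSingularities.ResolutionOfSingularities.Theorems.HomologicalConductor.PersistenceHullTransfer

/-! ## Step 2 — the reflexive hull of a lattice inherits stable annihilation -/

section Hull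

variable {S : Type u} [CommRing S] [IsDomain S]
variable {W : Type v} [AddCommGroup W] [Module S W]
variable {K : Type w} [Field K] [Algebra S K] [Module K W] [IsScalarTower S K W]

/-- **Stable annihilation passes to the reflexive hull** (R5.8 of the idea-2 Sketch, Fin-indexed form).
For a finitely generated submodule `N` of a vector space `W` over a field `K ⊇ S` through which the domain
`S` acts, if `π ∘ ι = x • id_N` through `Sˢ`, then `x • id` of `reflexiveHull N ⊆ W` factors through `Sˢ`
as well: transport the double-dual factorisation (`exists_comp_eq_smul_id_dual_dual`) along
`reflexiveHullEquiv : reflexiveHull N ≃ₗ[S] N**`. [cite: BrunsHerzog1998, Prop. 1.4.1] -/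
theorem exists_comp_eq_smul_id_reflexiveHull [NoZeroSMulDivisors S W] [FaithfulSMul S K]
    (N : Submodule S W) [Module.Finite S N] {x : S} {s : ℕ} (ι : N →ₗ[S] (Fin s → S))
    (π : (Fin s → S) →ₗ[S] N) (h : π ∘ₗ ι = x • LinearMap.id) :
    ∃ (ι' : reflexiveHull N →ₗ[S] (Fin s → S)) (π' : (Fin s → S) →ₗ[S] reflexiveHull N),
      π' ∘ₗ ι' = x • LinearMap.id := by
  obtain ⟨ι₂, π₂, h₂⟩ := exists_comp_eq_smul_id_dual_dual ι π h
  let e : reflexiveHull N ≃ₗ[S] Dual S (Dual S N) := reflexiveHullEquiv (K := K) N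
  exact exists_comp_eq_smul_id_of_retract ι₂ π₂ h₂ e.toLinearMap e.symm.toLinearMap
    (LinearMap.ext fun w => e.symm_apply_apply w)

end Hull

section HullExt

variable {S : Type u} [CommRing S] [IsDomain S]
variable {W : Type u} [AddCommGroup W] [Module S W]
variable {K : Type w} [Field K] [Algebra S K] [Module K W] [IsScalarTower S K W]

/-- **`Ext` form of step 2.** In the situation of `exists_comp_eq_smul_id_reflexiveHull`, `x` kills
`Extⁱ_S(reflexiveHull N, M)` for every `S`-module `M` and every `i ≥ 1`
(`smul_ext_eq_zero_of_linearMap_comp_eq_smul_id`). [cite: BrunsHerzog1998, Prop. 1.4.1] -/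
theorem smul_ext_eq_zero_reflexiveHull [NoZeroSMulDivisors S W] [FaithfulSMul S K]
    (N : Submodule S W) [Module.Finite S N] {x : S} {s : ℕ} (ι : N →ₗ[S] (Fin s → S))
    (π : (Fin s → S) →ₗ[S] N) (h : π ∘ₗ ι = x • LinearMap.id)
    (M : ModuleCat.{u} S) {i : ℕ} (hi : 1 ≤ i) (e : Ext.{u} (ModuleCat.of S (reflexiveHull N)) M i) :
    x • e = 0 := by
  obtain ⟨ι', π', h'⟩ := exists_comp_eq_smul_id_reflexiveHull (K := K) N ι π h
  exact smul_ext_eq_zero_of_linearMap_comp_eq_smul_id ι' π' h' M hi e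

end HullExt

/-! ## Step 1 — birational descent of a stable FACTORISATION to the span -/

section Birational

variable {B C : Type u} [CommRing B] [CommRing C] [Algebra B C]

/-- **Birational descent of a stable factorisation (abstract form).** Let `B → C` be birational (every
`s : C` has `b · s = r · 1` with `b ∈ B⁰`, `r : B`) with `C` torsion-free over `B`, `Y₀` a `B`-module with
`π₀ ∘ ι₀ = c • id` through `Bˢ`, and `Y` a `C`-module spanned over `C` by the image of an injective
`B`-linear `φ : Y₀ → Y`.  Then `(algebraMap B C c) • id_Y` factors `C`-linearly through `Cˢ`: base change to
`C ⊗ Y₀ → C ⊗ Bˢ` (`baseChange_comp_baseChange_eq_smul_id`), descend along the multiplication map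
`C ⊗ Y₀ ↠ Y` whose `B⁰`-torsion kernel dies in the `B`-torsion-free `C ⊗ Bˢ` (`ker_liftBaseChange_le_ker`,
`isTorsionFree_baseChange`, `exists_comp_eq_smul_id_of_surjective`), and identify `C ⊗ Bˢ ≅ Cˢ`
(`TensorProduct.piScalarRight`). [folklore] -/
theorem exists_comp_eq_smul_id_of_isBirational [Module.IsTorsionFree B C] {Y₀ : Type u}
    [AddCommGroup Y₀] [Module B Y₀] {c : B} {s : ℕ} (ι₀ : Y₀ →ₗ[B] (Fin s → B))
    (π₀ : (Fin s → B) →ₗ[B] Y₀) (h : π₀ ∘ₗ ι₀ = c • LinearMap.id)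
    (hbir : ∀ s : C, ∃ b : B, b ∈ nonZeroDivisors B ∧ ∃ r : B, algebraMap B C b * s = algebraMap B C r)
    {Y : Type u} [AddCommGroup Y] [Module C Y] [Module B Y] [IsScalarTower B C Y]
    (φ : Y₀ →ₗ[B] Y) (hφ : Function.Injective φ) (hspan : Submodule.span C (Set.range φ) = ⊤) :
    ∃ (ι : Y →ₗ[C] (Fin s → C)) (π : (Fin s → C) →ₗ[C] Y),
      π ∘ₗ ι = algebraMap B C c • LinearMap.id := by
  classical
  haveI := isTorsionFree_baseChange B C (Fin s → B)
  -- base change of the factorisation to `C ⊗ Y₀ → C ⊗ Bˢ → C ⊗ Y₀`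
  have h₁ := baseChange_comp_baseChange_eq_smul_id (C := C) ι₀ π₀ h
  -- descent along the multiplication map `C ⊗ Y₀ ↠ Y`
  obtain ⟨ι₂, π₂, h₂⟩ := exists_comp_eq_smul_id_of_surjective (ι₀.baseChange C) (π₀.baseChange C) h₁
    (φ.liftBaseChange C) (liftBaseChange_surjective_of_span_eq_top φ hspan)
    (ker_liftBaseChange_le_ker φ hφ hbir (ι₀.baseChange C))
  -- `C ⊗ Bˢ ≅ Cˢ`
  let e : C ⊗[B] (Fin s → B) ≃ₗ[C] (Fin s → C) := TensorProduct.piScalarRight B C C (Fin s)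
  refine ⟨e.toLinearMap ∘ₗ ι₂, π₂ ∘ₗ e.symm.toLinearMap, LinearMap.ext fun y => ?_⟩
  have hy : π₂ (ι₂ y) = algebraMap B C c • y := LinearMap.congr_fun h₂ y
  simp only [LinearMap.comp_apply, LinearEquiv.coe_toLinearMap, LinearEquiv.symm_apply_apply, hy,
    LinearMap.smul_apply, LinearMap.id_apply]

end Birational

/-! ## Steps 1 + 2 + 3 for subalgebras `T₀ ≤ S` of a field -/

section Subalgebra

-- the `↥C`-module structure of `reflexiveHull Y ⊆ V` is found through the tower `↥C → K → V`;
-- the default instance budget is too small for `HSMul ↥C (reflexiveHull Y →ₗ[↥C] reflexiveHull Y)`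
set_option synthInstance.maxHeartbeats 200000

variable {k : Type*} {K : Type u} [CommRing k] [Field K] [Algebra k K] {B C : Subalgebra k K}

/-- A `K`-vector space has no zero smul-divisors over a subalgebra `C ⊆ K` (non-zero elements of `C` are
units of `K`). [folklore] -/
theorem Subalgebra.noZeroSMulDivisors_left (C : Subalgebra k K) (V : Type*) [AddCommGroup V]
    [Module K V] : NoZeroSMulDivisors C V :=
  ⟨fun {c v} h => by
    rw [Subalgebra.smul_def] at h
    rcases smul_eq_zero.mp h with h | h
    · exact Or.inl (Subtype.ext h)
    · exact Or.inr h⟩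

/-- **Step 1 for subalgebras of a field: a stable factorisation descends to the span.** Let `B`, `C` be
subalgebras of a field `K` with an algebra structure `↥B → ↥C` compatible with the inclusions into `K`
(e.g. the inclusion of `B ≤ C`) and `C ⊆ Frac B` inside `K`; `Y₀ ⊆ V` a `↥B`-submodule of a `K`-vector
space and `Y = C · Y₀` its `↥C`-span.  If `π₀ ∘ ι₀ = c • id_{Y₀}` through `Bˢ` (`c : B`), then
`(algebraMap B C c) • id_Y` factors `↥C`-linearly through `Cˢ` (`exists_comp_eq_smul_id_of_isBirational`
applied to the inclusion `Y₀ → Y`). [folklore] -/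
theorem Subalgebra.exists_comp_eq_smul_id_of_span_eq [Algebra B C] [IsScalarTower B C K]
    (hfrac : ∀ s ∈ C, ∃ b ∈ B, b ≠ 0 ∧ b * s ∈ B)
    {V : Type u} [AddCommGroup V] [Module K V] {Y₀ : Submodule B V} {Y : Submodule C V}
    (hY : Submodule.span C (Y₀ : Set V) = Y) {c : B} {s : ℕ}
    (ι₀ : Y₀ →ₗ[B] (Fin s → B)) (π₀ : (Fin s → B) →ₗ[B] Y₀) (h : π₀ ∘ₗ ι₀ = c • LinearMap.id) :
    ∃ (ι : Y →ₗ[C] (Fin s → C)) (π : (Fin s → C) →ₗ[C] Y),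
      π ∘ₗ ι = algebraMap B C c • LinearMap.id := by
  haveI := Subalgebra.isScalarTower_module (B := B) (C := C) V
  haveI : Module.IsTorsionFree B C := Subalgebra.isTorsionFree_of_isScalarTower
  have hle : (Y₀ : Set V) ⊆ Y := hY ▸ Submodule.subset_span
  let φ : Y₀ →ₗ[B] Y :=
    { toFun := fun y => ⟨y, hle y.2⟩
      map_add' := fun _ _ => rfl
      map_smul' := fun _ _ => rfl }
  have hφ : Function.Injective φ := fun y₁ y₂ h12 =>
    Subtype.ext (congrArg (Subtype.val : Y → V) h12)
  have himg : (Subtype.val : Y → V) '' Set.range φ = (Y₀ : Set V) := by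
    ext v
    constructor
    · rintro ⟨_, ⟨y, rfl⟩, rfl⟩
      exact y.2
    · intro hv
      exact ⟨⟨v, hle hv⟩, ⟨⟨v, hv⟩, rfl⟩, rfl⟩
  have hspan : Submodule.span C (Set.range φ) = ⊤ := by
    apply Submodule.map_injective_of_injective Y.injective_subtype
    rw [Submodule.map_span, Submodule.map_top, Submodule.range_subtype, Submodule.coe_subtype,
      himg, hY]
  exact exists_comp_eq_smul_id_of_isBirational ι₀ π₀ h
    (Subalgebra.exists_mem_nonZeroDivisors_mul_eq hfrac) φ hφ hspan

/-- **THE HULL LEMMA, factorisation form** (steps 1 + 2).  Subalgebras `B`, `C` of a field `K` with a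
compatible algebra structure `↥B → ↥C` and `C ⊆ Frac B` inside `K`; `Y₀ ⊆ V` a `↥B`-submodule of a
`K`-vector space whose `↥C`-span `Y` is finitely generated.  If `c • id_{Y₀}` (`c : B`) factors
`↥B`-linearly through `Bˢ`, then `(algebraMap B C c) • id` of the reflexive hull `Y** = reflexiveHull Y ⊆ V`
factors `↥C`-linearly through `Cˢ`. [cite: BrunsHerzog1998, Prop. 1.4.1] -/
theorem Subalgebra.exists_comp_eq_smul_id_reflexiveHull_of_span_eq [Algebra B C] [IsScalarTower B C K]
    (hfrac : ∀ s ∈ C, ∃ b ∈ B, b ≠ 0 ∧ b * s ∈ B)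
    {V : Type u} [AddCommGroup V] [Module K V] {Y₀ : Submodule B V} {Y : Submodule C V}
    (hY : Submodule.span C (Y₀ : Set V) = Y) [Module.Finite C Y] {c : B} {s : ℕ}
    (ι₀ : Y₀ →ₗ[B] (Fin s → B)) (π₀ : (Fin s → B) →ₗ[B] Y₀) (h : π₀ ∘ₗ ι₀ = c • LinearMap.id) :
    ∃ (ι : reflexiveHull Y →ₗ[C] (Fin s → C)) (π : (Fin s → C) →ₗ[C] reflexiveHull Y),
      π ∘ₗ ι = algebraMap B C c • (LinearMap.id : reflexiveHull Y →ₗ[C] reflexiveHull Y) := by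
  haveI := Subalgebra.noZeroSMulDivisors_left C V
  obtain ⟨ι₁, π₁, h₁⟩ := Subalgebra.exists_comp_eq_smul_id_of_span_eq hfrac hY ι₀ π₀ h
  exact exists_comp_eq_smul_id_reflexiveHull (K := K) Y ι₁ π₁ h₁

/-- **THE HULL LEMMA, `Ext` form** (steps 1 + 2 + 3; memo ROUND5-FASC §3 (H)).  Subalgebras `B`, `C` of
a field `K` with a compatible algebra structure `↥B → ↥C` and `C ⊆ Frac B` inside `K` (e.g. `C` = the
normalisation of `B` inside `Frac B`); `Y₀ ⊆ V` a `↥B`-submodule of a `K`-vector space whose `↥C`-span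
`Y` is finitely generated.  If `c • id_{Y₀}` (`c : B`) factors `↥B`-linearly through a finite free
`Bˢ` — i.e. `c` STABLY ANNIHILATES `Y₀` over `B` — then `c` kills `Extⁱ_C(Y**, N)` for the reflexive hull
`Y** = reflexiveHull Y ⊆ V`, every `↥C`-module `N` and every `i ≥ 1`; exponent one throughout.
[cite: BrunsHerzog1998, Prop. 1.4.1] -/
theorem Subalgebra.smul_ext_eq_zero_reflexiveHull_of_span_eq [Algebra B C] [IsScalarTower B C K]
    (hfrac : ∀ s ∈ C, ∃ b ∈ B, b ≠ 0 ∧ b * s ∈ B)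
    {V : Type u} [AddCommGroup V] [Module K V] {Y₀ : Submodule B V} {Y : Submodule C V}
    (hY : Submodule.span C (Y₀ : Set V) = Y) [Module.Finite C Y] {c : B} {s : ℕ}
    (ι₀ : Y₀ →ₗ[B] (Fin s → B)) (π₀ : (Fin s → B) →ₗ[B] Y₀) (h : π₀ ∘ₗ ι₀ = c • LinearMap.id)
    (N : ModuleCat.{u} C) {i : ℕ} (hi : 1 ≤ i)
    (e : Ext.{u} (ModuleCat.of C (reflexiveHull Y)) N i) :
    algebraMap B C c • e = 0 := by
  obtain ⟨ι, π, hιπ⟩ := Subalgebra.exists_comp_eq_smul_id_reflexiveHull_of_span_eq hfrac hY ι₀ π₀ h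
  exact smul_ext_eq_zero_of_linearMap_comp_eq_smul_id ι π hιπ N hi e

/-- **The hull lemma for a bare inclusion `B ≤ C`, factorisation form** (the instance plumbing made
explicit: `↥B → ↥C` is `Subalgebra.inclusion`, and the conclusion is about `Subalgebra.inclusion hBC c`).
[cite: BrunsHerzog1998, Prop. 1.4.1] -/
theorem Subalgebra.exists_comp_eq_smul_id_reflexiveHull_of_le_of_span_eq (hBC : B ≤ C)
    (hfrac : ∀ s ∈ C, ∃ b ∈ B, b ≠ 0 ∧ b * s ∈ B)
    {V : Type u} [AddCommGroup V] [Module K V] {Y₀ : Submodule B V} {Y : Submodule C V}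
    (hY : Submodule.span C (Y₀ : Set V) = Y) [Module.Finite C Y] {c : B} {s : ℕ}
    (ι₀ : Y₀ →ₗ[B] (Fin s → B)) (π₀ : (Fin s → B) →ₗ[B] Y₀) (h : π₀ ∘ₗ ι₀ = c • LinearMap.id) :
    ∃ (ι : reflexiveHull Y →ₗ[C] (Fin s → C)) (π : (Fin s → C) →ₗ[C] reflexiveHull Y),
      π ∘ₗ ι = Subalgebra.inclusion hBC c • (LinearMap.id : reflexiveHull Y →ₗ[C] reflexiveHull Y) :=
  letI := (Subalgebra.inclusion hBC).toRingHom.toAlgebra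
  haveI := Subalgebra.isScalarTower_inclusion hBC
  Subalgebra.exists_comp_eq_smul_id_reflexiveHull_of_span_eq hfrac hY ι₀ π₀ h

/-- **The hull lemma for a bare inclusion `B ≤ C`, `Ext` form**: for subalgebras `B ≤ C` of a field `K`
with `C ⊆ Frac B` inside `K`, a `↥B`-submodule `Y₀` of a `K`-vector space with finitely generated `↥C`-span
`Y`, and `c : B` stably annihilating `Y₀` over `B` through a finite free module, the element `c ∈ C` kills
`Extⁱ_C(reflexiveHull Y, N)` for every `↥C`-module `N` and every `i ≥ 1`.
[cite: BrunsHerzog1998, Prop. 1.4.1] -/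
theorem Subalgebra.smul_ext_eq_zero_reflexiveHull_of_le_of_span_eq (hBC : B ≤ C)
    (hfrac : ∀ s ∈ C, ∃ b ∈ B, b ≠ 0 ∧ b * s ∈ B)
    {V : Type u} [AddCommGroup V] [Module K V] {Y₀ : Submodule B V} {Y : Submodule C V}
    (hY : Submodule.span C (Y₀ : Set V) = Y) [Module.Finite C Y] {c : B} {s : ℕ}
    (ι₀ : Y₀ →ₗ[B] (Fin s → B)) (π₀ : (Fin s → B) →ₗ[B] Y₀) (h : π₀ ∘ₗ ι₀ = c • LinearMap.id)
    (N : ModuleCat.{u} C) {i : ℕ} (hi : 1 ≤ i)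
    (e : Ext.{u} (ModuleCat.of C (reflexiveHull Y)) N i) :
    Subalgebra.inclusion hBC c • e = 0 :=
  letI := (Subalgebra.inclusion hBC).toRingHom.toAlgebra
  haveI := Subalgebra.isScalarTower_inclusion hBC
  Subalgebra.smul_ext_eq_zero_reflexiveHull_of_span_eq hfrac hY ι₀ π₀ h N hi e

end Subalgebra

end Summit.ResolutionOfSingularities.ResolutionOfSingularities.Theorems.HomologicalConductor.PersistenceReflexiveHullTransfer

end
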